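import Literature.Probability.RandomPlanarGeometry.YangBaxterSAWLaw
import Literature.Probability.RandomPlanarGeometry.ChordalCurveFamily
import Mathlib.Combinatorics.SimpleGraph.Paths
import HarnessLib

/-!
# Crux `HexTransfer` (stmt-CriticalPhenomena-14221), line `yb-relay`: the `π/3` dictionary vocabulary

Reviewed definitions file (route-posited objects, `<Route>Defs` convention) for the skeleton
`Cruxes/HexTransfer/Lines/yb_relay.lean` (v2, line lead prover-line-stmt-CriticalPhenomena-14221-c4-0)
and its stubs `stub_thirdBdryEndpoints`, `stub_gmHexDictionary`, `stub_hexFaceRobust`,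
`stub_dictionaryGlue`: the combinatorial/geometric vocabulary in which "at `Θ ≡ π/3` the
Glazman–Manolescu Yang–Baxter walk IS the hexagonal SAW" (A. Glazman, I. Manolescu, arXiv:1708.00395,
§1 p. 3 and Fig. 2) is stated at the level of the finite-domain laws `ybLaw (fun _ => π/3)` and
`hexSAWLaw`:

* `third` — the constant angle sequence `π/3`;
* `IsBdryEdge Δ e` — exactly one of the two faces of the mid-edge `e` lies in the face set `Δ`;
* `triWN f`, `triSE f` — the two honeycomb vertices (`HexVertex`, embedded by `hexCenter`) carried by the
  two equilateral triangles of the rhombus `f = (k, j)` of `H(π/3)`: after the similarity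
  `S_δ z = i z − i δ/2` (`gmSimilarity δ`), the triangle containing the sides `W, N` of `(k, j)` is the
  "down" triangle `(![j, -k-1], 1)` and the one containing `S, E` is the "up" triangle `(![j, -k-1], 0)`
  (computed from `planeCorner`/`colShift` at `π/3`: corner lattice `ℤ i + ℤ e^{-iπ/6} − i/2`, and
  `hexCenter`: centres `ℤ + ℤζ + {(1+ζ)/3, 2(1+ζ)/3}`; checked on `vert 0 0 ↦ 0`);
* `triAt g e`, `inclFace Δ e`, `bdryVertex Δ e` — the triangle of the face of `Δ` resting on a boundary
  edge `e` (where a walk of `Δ` started at `e` makes its first visit);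
* `faceAdj Δ`, `faceComp Δ e`, `faceUnion Δ e δ`, `faceDomain Ω δ e` — the adjacency graph of the faces of
  `Δ` (as in `…CompassEndpointsFaceChains`), the face component at `e`, the union of its rescaled closed
  rhombi, and the FACE DOMAIN: the `S_δ`-preimage of the interior of that union, a planar domain whose
  canonical hexagonal discretisation `embDomainGraph hexGraph hexCenter · δ` is exactly the honeycomb
  graph the Yang–Baxter walks of `Ω_δ` started at `e` run on.

Definitions only (all with parameters or data-valued; no parameterless `def … : Prop`). Nothing is
proved here.
-/

noncomputable section

namespace Summit.CriticalPhenomena.SAWScalingLimit.Cruxes.HexTransfer.YbRelay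

open Complex (I I_ne_zero)
open Literature.Probability.RandomPlanarGeometry
open Literature.Probability.RandomPlanarGeometry.SAW.YangBaxter
open Literature.Probability.LatticeModels (HexVertex hexCenter)

/-! ### The `π/3` dictionary: faces, triangles, the similarity, the face domain -/

/-- The constant angle sequence `π/3` (the hexagonal point of the Yang–Baxter family). [folklore] -/
abbrev third : ℤ → ℝ := fun _ => Real.pi / 3

/-- A mid-edge is a **boundary edge** of the face set `Δ` if exactly one of its two faces lies in
`Δ` (a walk of `Δ` can only start or stop there). [folklore] -/
def IsBdryEdge (Δ : Set Face) (e : MidEdge) : Prop :=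
  (e.faces.1 ∈ Δ ∧ e.faces.2 ∉ Δ) ∨ (e.faces.1 ∉ Δ ∧ e.faces.2 ∈ Δ)

/-- The honeycomb vertex carried by the equilateral triangle of the rhombus `f = (k, j)` of `H(π/3)`
containing its sides `W, N` (a "down" triangle of `hexCenter`'s honeycomb after the similarity
`z ↦ i z − i/2`). [cite: GlazmanManolescu2019, §1, Fig. 2] -/
def triWN (f : Face) : HexVertex := (![f.2, -f.1 - 1], 1)

/-- The honeycomb vertex carried by the triangle of `f = (k, j)` containing its sides `S, E` (an "up"
triangle). [cite: GlazmanManolescu2019, §1, Fig. 2] -/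
def triSE (f : Face) : HexVertex := (![f.2, -f.1 - 1], 0)

/-- The triangle of the face `g` resting on the mid-edge `e` (a side of `g`). [folklore] -/
def triAt (g : Face) (e : MidEdge) : HexVertex :=
  if e = g.side .W ∨ e = g.side .N then triWN g else triSE g

open Classical in
/-- The face of `Δ` bordering the mid-edge `e` (the first one if both do). [folklore] -/
def inclFace (Δ : Set Face) (e : MidEdge) : Face :=
  if e.faces.1 ∈ Δ then e.faces.1 else e.faces.2

/-- **The boundary vertex of a boundary edge**: the honeycomb vertex of the triangle of the (unique)
face of `Δ` resting on `e` — where a Yang–Baxter walk of `Δ` started at `e` makes its first visit.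
[folklore] -/
def bdryVertex (Δ : Set Face) (e : MidEdge) : HexVertex :=
  triAt (inclFace Δ e) e

/-- The similarity `S_δ : z ↦ i z − i δ/2` carrying `δ · hexCenter` (the honeycomb of `HexSAW.lean`) onto
the honeycomb of triangle centres of Glazman–Manolescu's tiling `H(π/3)` at mesh `δ` (origin = midpoint
of `vert 0 0`). [folklore] -/
def gmSimilarity (δ : ℝ) : ℂ ≃ₜ ℂ :=
  similarity I I_ne_zero (-(I * (δ : ℂ) / 2))

/-- The adjacency graph of the faces of `Δ` (two faces of `Δ` sharing a side), written with
`SimpleGraph.fromRel` exactly as in `…CompassEndpointsFaceChains`. [folklore] -/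
def faceAdj (Δ : Set Face) : SimpleGraph Face :=
  SimpleGraph.fromRel fun f g : Face =>
    (∃ e : MidEdge, (∃ s, f.side s = e) ∧ ∃ t, g.side t = e) ∧ f ∈ Δ ∧ g ∈ Δ

/-- The face component of `Δ` at the mid-edge `e`: the faces of `Δ` joined to the face of `Δ` bordering
`e` by a chain of faces of `Δ`. [folklore] -/
def faceComp (Δ : Set Face) (e : MidEdge) : Set Face :=
  {g | g ∈ Δ ∧ (faceAdj Δ).Reachable (inclFace Δ e) g}

/-- The union of the rescaled closed rhombi of the face component of `Δ` at `e`. [folklore] -/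
def faceUnion (Δ : Set Face) (e : MidEdge) (δ : ℝ) : Set ℂ :=
  ⋃ g ∈ faceComp Δ e, (fun z : ℂ => (δ : ℂ) * z) '' rhombus third g

/-- **The face domain** of `Ω` at mesh `δ` seen from the mid-edge `e`, in `hexCenter` coordinates: the
preimage under `S_δ` of the interior of the union of the closed rhombi of the face component of `Ω_δ`
at `e`. Its canonical hexagonal discretisation (`embMeshDomain hexGraph hexCenter · δ`) is exactly the
honeycomb graph the Yang–Baxter walks of `Ω_δ` from `e` run on. [folklore] -/
def faceDomain (Ω : Set ℂ) (δ : ℝ) (e : MidEdge) : Set ℂ :=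
  (gmSimilarity δ).symm '' interior (faceUnion (meshFaces third Ω δ) e δ)

/-! ### API -/

/-- Pointwise formula for the similarity `S_δ`: `S_δ z = i z − i δ / 2`. [folklore] -/
theorem gmSimilarity_apply : ∀ (δ : ℝ) (z : ℂ), gmSimilarity δ z = I * z - I * (δ : ℂ) / 2 := by
  intro δ z
  simp only [gmSimilarity, similarity_apply]
  ring

/-- `S_δ` sends the honeycomb vertex `hexCenter (triWN (0, 0))` (mesh `1`) to the centre `√3/6` of the
`W–N` triangle of the face `(0, 0)` of `H(π/3)` and the origin-adjacent hex edge midpoint to `0`: the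
midpoint of `vert 0 0` is the midpoint of the honeycomb edge `{triWN (0,0), triSE (-1,0)}`, i.e.
`S_1 ((hexCenter (triWN (0, 0)) + hexCenter (triSE (-1, 0))) / 2) = 0`. [folklore] -/
theorem gmSimilarity_one_midpoint_origin :
    gmSimilarity 1 ((hexCenter (triWN (0, 0)) + hexCenter (triSE (-1, 0))) / 2) = 0 := by
  simp [gmSimilarity, hexCenter, triWN, triSE, Literature.Probability.LatticeModels.triEmbed]
  ring

end Summit.CriticalPhenomena.SAWScalingLimit.Cruxes.HexTransfer.YbRelay

end
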